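import Mathlib
import HarnessLib
import Summits.NavierStokesRegularity.NavierStokesRegularity.Theorems.TypeILiouvilleTypeIDoorLocalAxis
import Summits.NavierStokesRegularity.NavierStokesRegularity.Theorems.TypeILiouvilleShorelineLocalSymmetry
import Summits.NavierStokesRegularity.NavierStokesRegularity.Theorems.ScenarioCensusHelicalTypeILiouville

/-!
# TypeILiouvilleTypeIDoorLocalHelix — crux (L) stmt-NavierStokesRegularity-10661 `TypeIliouvilleL`, registered stub
# `stub_typeIAncientLiouville_knssGauge` (= door stmt-4050): A TYPE-I PROFILE WITH ONE LOCALLY HELICAL PATCH IS ZERO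

Helper for stmt-NavierStokesRegularity-10661 (`--supports`); theorems only, no definitions, no named-fact hypotheses;
closes no item; Navier–Stokes regularity is NOT proved here (leafhand seat of the EulerZoomLiouville route; sequel to
`TypeILiouvilleTypeIDoorLocalAxis`).

The HELICAL time-Type-I cell of the door is CLOSED in the tree (census row A8t:
`ScenarioCensus.PitchDefect.helical_typeI_liouville_genuine` — a KNSS-gauge Type-I ancient mild field whose slices are
helically symmetric with pitch `h ≠ 0`, `V τ (R_θ y + hθ e₃) = R_θ (V τ y)`, vanishes).  As for the axis cell, the
symmetry certificate LOCALIZES to one open patch of one slice: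

* `typeI_helical_of_locally` — if `V τ₁` (`τ₁ < 0`) coincides on ONE nonempty open set with each of its SCREW twins
  `x ↦ R_θ (V τ₁ (R_θ⁻¹ (x − hθ e₃)))`, then EVERY slice of `V` is helically symmetric with pitch `h` (backward shift into
  class P, `typeI_shift_classP`; the screw twin of a class-P flow is in class P — `classP_conj_linearIsometryEquiv` +
  `classP_spaceShift`; one-patch determination `classP_eq_of_slice_locallyEq`; every `τ < 0` is reached by a small shift).
* `typeI_eq_zero_of_locally_helical` — **hence `V ≡ 0`** (`helical_typeI_liouville_genuine` with resting axis);
  `typeIAncientLiouville_onLocalHelix` — the reading on the binders of stmt-4050 / the registered stub VERBATIM.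

READING: a counterexample to the load-bearing door has, on no slice, an open patch on which it is rotationally OR screw
symmetric about the vertical axis (any pitch `h ≠ 0`; `h = 0` is `TypeILiouvilleTypeIDoorLocalAxis`).
[cite: KochNadirashviliSereginSverak2009, §1, Thm 5.2 and p. 10 (arXiv:0709.3599); LemarieRieusset2016, Thm. 9.12 (PDF p. 260)]
-/

noncomputable section

open MeasureTheory Filter Set Function Metric
open scoped Topology
open Literature.Analysis Literature.Analysis.FluidPDE Literature.Analysis.UnboundedOperators
open Summit.NavierStokesRegularity.NavierStokesRegularity.Theorems.TypeILiouvilleShoreline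
open Summit.NavierStokesRegularity.NavierStokesRegularity.Theorems.TypeILiouvilleTypeIDoorLocalAxis

set_option linter.dupNamespace false

namespace Summit.NavierStokesRegularity.NavierStokesRegularity.Theorems.TypeILiouvilleTypeIDoorLocalHelix

variable {K : ℝ} {W : ℝ → EuclideanSpace ℝ (Fin 3) → EuclideanSpace ℝ (Fin 3)}

/-- **LOCAL SCREW SYMMETRY OF ONE SLICE OF A TYPE-I FIELD IS HELICAL SYMMETRY OF EVERY SLICE.**  If `V τ₁` (`τ₁ < 0`)
coincides on ONE nonempty open set with its screw twins `x ↦ R_θ (V τ₁ (R_θ⁻¹ (x − hθ e₃)))` (all `θ`), then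
`V τ (R_θ y + hθ e₃) = R_θ (V τ y)` for all `τ < 0`, `θ`, `y`. [cite: LemarieRieusset2016, Thm. 9.12 (PDF p. 260)] -/
theorem typeI_helical_of_locally (hW : IsTypeIAncientMild K W) (h : ℝ)
    {τ₁ : ℝ} (hτ₁ : τ₁ < 0) {U : Set (EuclideanSpace ℝ (Fin 3))} (hUo : IsOpen U) (hUne : U.Nonempty)
    (hloc : ∀ θ : ℝ, ∀ x ∈ U, W τ₁ x =
      rotZLIE θ (W τ₁ ((rotZLIE θ).symm (x - (h * θ) • EuclideanSpace.single 2 (1 : ℝ))))) :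
    ∀ τ < 0, ∀ (θ : ℝ) (y : EuclideanSpace ℝ (Fin 3)),
      W τ (rotZ θ y + (h * θ) • EuclideanSpace.single 2 (1 : ℝ)) = rotZ θ (W τ y) := by
  intro τ hτ θ y
  -- a small backward shift reaching both `τ₁` and `τ`
  set δ : ℝ := min (-τ₁) (-τ) / 2 with hδ_def
  have hδ : 0 < δ := by
    rw [hδ_def]; have := lt_min (neg_pos.2 hτ₁) (neg_pos.2 hτ); linarith
  have hδ₁ : τ₁ + δ < 0 := by
    rw [hδ_def]; have := min_le_left (-τ₁) (-τ); linarith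
  have hδτ : τ + δ < 0 := by
    rw [hδ_def]; have := min_le_right (-τ₁) (-τ); linarith
  obtain ⟨hc, hK, hm⟩ := typeI_shift_classP hW hδ
  -- the screw twin of the shifted flow is in class P
  set R := rotZLIE θ with hR
  set p : EuclideanSpace ℝ (Fin 3) := (h * θ) • EuclideanSpace.single 2 (1 : ℝ) with hp
  obtain ⟨h1c, h1K, h1m⟩ := classP_conj_linearIsometryEquiv (v := fun t x => W (t - δ) x) hc hK hm R
  obtain ⟨h2c, h2K, h2m⟩ :=
    classP_spaceShift (v := fun t x => R (W (t - δ) (R.symm x))) h1c h1K h1m (-p)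
  -- agreement on `U` at time `τ₁ + δ`
  have hagree : ∀ x ∈ U, (fun t x => W (t - δ) x) (τ₁ + δ) x =
      (fun t x => R (W (t - δ) (R.symm (x + -p)))) (τ₁ + δ) x := by
    intro x hx
    simp only [add_sub_cancel_right, ← sub_eq_add_neg]
    exact hloc θ x hx
  have hglob := classP_eq_of_slice_locallyEq hc hK hm h2c h2K h2m hδ₁ hUo hUne hagree (τ + δ) hδτ (R y + p)
  simp only [add_sub_cancel_right, ← sub_eq_add_neg, add_sub_cancel_right, LinearIsometryEquiv.symm_apply_apply] at hglob
  rw [hR, rotZLIE_apply] at hglob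
  exact hglob

/-- **A KNSS-GAUGE TYPE-I ANCIENT MILD FIELD WITH ONE LOCALLY HELICAL PATCH VANISHES** (pitch `h ≠ 0`): local ⟹ global
helical symmetry (`typeI_helical_of_locally`) and the tree's helical time-Type-I Liouville theorem
`ScenarioCensus.PitchDefect.helical_typeI_liouville_genuine` (resting axis). [cite: KochNadirashviliSereginSverak2009, §1 and Thm 5.2 (arXiv:0709.3599)] -/
theorem typeI_eq_zero_of_locally_helical (hW : IsTypeIAncientMild K W) {h : ℝ} (hh : h ≠ 0)
    {τ₁ : ℝ} (hτ₁ : τ₁ < 0) {U : Set (EuclideanSpace ℝ (Fin 3))} (hUo : IsOpen U) (hUne : U.Nonempty)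
    (hloc : ∀ θ : ℝ, ∀ x ∈ U, W τ₁ x =
      rotZLIE θ (W τ₁ ((rotZLIE θ).symm (x - (h * θ) • EuclideanSpace.single 2 (1 : ℝ))))) :
    ∀ τ < 0, ∀ y, W τ y = 0 := by
  have hhel := typeI_helical_of_locally hW h hτ₁ hUo hUne hloc
  refine ScenarioCensus.PitchDefect.helical_typeI_liouville_genuine (A := fun _ => 0) hh hW fun τ hτ θ y => ?_
  have h0 : rotZ θ (0 : EuclideanSpace ℝ (Fin 3)) = 0 := (rotZL θ).map_zero
  simp only [h0, sub_zero, zero_add]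
  exact hhel τ hτ θ y

/-- **Reading on the door / the registered stub VERBATIM.**  With the binders of
`Theses.SymmetryModuliCount.TypeIAncientLiouville` (stmt-4050) = `stub_typeIAncientLiouville_knssGauge`: a smooth,
divergence-free, Oseen-kernel-mild, Type-I-in-time field one of whose slices coincides, on one nonempty open patch, with all
its screw twins about the vertical axis (some pitch `h ≠ 0`) vanishes identically.
[cite: KochNadirashviliSereginSverak2009, §1 and Thm 5.2 (arXiv:0709.3599)] -/
theorem typeIAncientLiouville_onLocalHelix :
    ∀ (C : ℝ) (u : ℝ → EuclideanSpace ℝ (Fin 3) → EuclideanSpace ℝ (Fin 3)),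
      ContDiffOn ℝ (⊤ : ℕ∞) (Function.uncurry u) (Set.Iio 0 ×ˢ Set.univ) ∧
      (∀ t < 0, Literature.Analysis.FluidPDE.VectorCalculus.IsDivFree (u t)) ∧
      (∀ s t : ℝ, s < t → t < 0 → ∀ x,
        u t x = Literature.Analysis.FluidPDE.heatFlow (u s) (t - s) x -
          ∫ τ in Set.Ioo s t, ∫ y,
            Literature.Analysis.FluidPDE.oseenKernel (t - τ) (x - y) (u τ y) (u τ y)) ∧
      Literature.Analysis.FluidPDE.HasTypeITimeDecay C u →
      (∃ (h τ₁ : ℝ) (U : Set (EuclideanSpace ℝ (Fin 3))), h ≠ 0 ∧ τ₁ < 0 ∧ IsOpen U ∧ U.Nonempty ∧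
          ∀ θ : ℝ, ∀ x ∈ U, u τ₁ x =
            rotZLIE θ (u τ₁ ((rotZLIE θ).symm (x - (h * θ) • EuclideanSpace.single 2 (1 : ℝ))))) →
      ∀ t < 0, ∀ x, u t x = 0 := by
  intro C u hu hloc
  obtain ⟨h, τ₁, U, hh, hτ₁, hUo, hUne, hrot⟩ := hloc
  exact typeI_eq_zero_of_locally_helical (isTypeIAncientMild_iff.2 hu) hh hτ₁ hUo hUne hrot

end Summit.NavierStokesRegularity.NavierStokesRegularity.Theorems.TypeILiouvilleTypeIDoorLocalHelix

end
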